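import Summits.BirchSwinnertonDyer.BirchSwinnertonDyer.Theorems.ResidualThetaTransportAtTwoThetaLayerLambdaCongruenceAtTwoCuspSpanCosetPropagation
import Summits.BirchSwinnertonDyer.BirchSwinnertonDyer.Theorems.ResidualThetaTransportAtTwoThetaLayerLambdaCongruenceAtTwoCuspSpanCharacterMoments
import Summits.BirchSwinnertonDyer.BirchSwinnertonDyer.Theorems.ResidualThetaTransportAtTwoThetaLayerLambdaCongruenceAtTwoCuspSpanJacobiLevels
import HarnessLib

/-!
# Route `ResidualThetaTransportAtTwo`, cruxes Kan⁺ (stmt-BirchSwinnertonDyer-20688) / node 27436 / 21437: **the node at every odd prime with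
# `p ≳ 3n³`** (`n = [𝔽ₚˣ : ⟨4,−1⟩]`) — second moment + one-step coboundary propagation

Cell `bsd-wall`, width seat `bsd-wall-rtt-p3-w5` g2 (2026-08-28). THEOREMS ONLY; `--supports stmt-BirchSwinnertonDyer-20688`; BSD is not proved
by this. Sharpening of `cuspSpanEvenAtTwo_of_index_le` (`…CuspSpanJacobi`, p638810; threshold `p ≳ n⁴`): the all-pairs requirement is replaced by
«every row of the cyclotomic matrix has fewer than a third unrealised entries» (`…CuspSpanCharacterMoments.exists_good_pivot`, second moment /
Parseval over `𝔽ₚ`) which feeds the one-step propagation criterion `cuspSpanEvenAtTwo_of_oneStep` (`…CuspSpanCosetPropagation`).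

THEOREM (`cuspSpanEvenAtTwo_of_index_le_moment`). `p` odd prime, `[𝔽ₚˣ : ⟨4,−1⟩] ≤ n`, `n + 1 ≤ p` and
`3(n−1)·(2 + (n−2)(⌊√p⌋+1))² < (p − 1 − n)²` ⟹ `CuspSpanEvenAtTwo p`. THRESHOLDS (all primes of index `n` from about): n=7: 940 → 631;
n=8: 1810 → 881; n=10: 5242 → 2210; n=12: 12170 → 4100; n=16: 44194 → 9900; n=20: 117082 → 19700 (exponent `4 → 3`; for `n ≤ 5` the
all-pairs inequality is the better one — use `cuspSpanEvenAtTwo_of_index_le`). Per-level wrappers `cuspSpanEvenAtTwo_of_check_moment(')` and the six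
instances `≤ 3000` that the all-pairs theorem missed: `631, 881, 1201, 1553, 1601, 2381`.

BARRIER NOTE (seat analysis): the per-row bound «unrealised entries ≤ n⁴/p» is the square-root (Weil) barrier of second-moment methods, so
depth-`k` propagation does not improve the exponent `3`; the residue at prime level remains the small-`⟨4⟩` primes, where the full cocycle
closure still succeeds numerically (`analysis/propagate.py`: every prime tested, ≤ 2 rounds) but is certified per level, not uniformly.

References: K. Ireland, M. Rosen, GTM 84, Ch. 8; [Manin1972] §1.5; [Pollack2003] Conj. 6.3.
-/

set_option autoImplicit false
set_option linter.dupNamespace false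

open scoped MatrixGroups

open CongruenceSubgroup

namespace Summit.BirchSwinnertonDyer.BirchSwinnertonDyer.Theorems.SignedMuAtTwo

section Main

variable {p : ℕ} [Fact p.Prime]

/-- The second-moment inequality is monotone in the index bound. [folklore] -/
theorem moment_ineq_mono {p k n s : ℕ} (hkn : k ≤ n)
    (h : n + 1 ≤ p ∧ 3 * (n - 1) * (2 + (n - 2) * s) ^ 2 < (p - 1 - n) ^ 2) :
    k + 1 ≤ p ∧ 3 * (k - 1) * (2 + (k - 2) * s) ^ 2 < (p - 1 - k) ^ 2 := by
  obtain ⟨h1, h2⟩ := h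
  have hk1 : k - 1 ≤ n - 1 := Nat.sub_le_sub_right hkn 1
  have hk2 : k - 2 ≤ n - 2 := Nat.sub_le_sub_right hkn 2
  refine ⟨by omega, ?_⟩
  calc 3 * (k - 1) * (2 + (k - 2) * s) ^ 2 ≤ 3 * (n - 1) * (2 + (n - 2) * s) ^ 2 :=
        Nat.mul_le_mul (Nat.mul_le_mul_left 3 hk1) (Nat.pow_le_pow_left (by nlinarith [Nat.mul_le_mul_right s hk2]) 2)
    _ < (p - 1 - n) ^ 2 := h2
    _ ≤ (p - 1 - k) ^ 2 := Nat.pow_le_pow_left (by omega) 2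

/-- **The node at every odd prime with `p ≳ 3n³` (second moment).** Let `H := ⟨4,−1⟩ ≤ 𝔽ₚˣ` have index `≤ n`, `n + 1 ≤ p`, and
`3(n−1)(2 + (n−2)(⌊√p⌋+1))² < (p−1−n)²`. Then `CuspSpanEvenAtTwo p`. [cite: Pollack2003, Conj. 6.3] [cite: Manin1972, §1.5] -/
theorem cuspSpanEvenAtTwo_of_index_le_moment (hp2 : p ≠ 2) {n : ℕ}
    (hn : (Subgroup.closure {w : (ZMod p)ˣ | (w : ZMod p) = 4 ∨ (w : ZMod p) = -1}).index ≤ n)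
    (hineq : n + 1 ≤ p ∧ 3 * (n - 1) * (2 + (n - 2) * (Nat.sqrt p + 1)) ^ 2 < (p - 1 - n) ^ 2) :
    CuspSpanEvenAtTwo p := by
  classical
  set H : Subgroup (ZMod p)ˣ := Subgroup.closure {w : (ZMod p)ˣ | (w : ZMod p) = 4 ∨ (w : ZMod p) = -1} with hH
  haveI : NeZero ((Monoid.exponent (ZMod p)ˣ : ℕ) : ℂ) := ⟨Nat.cast_ne_zero.mpr Monoid.exponent_ne_zero_of_finite⟩
  haveI : Fintype (MulChar (ZMod p) ℂ) := Fintype.ofFinite _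
  set X₀ : Subgroup (MulChar (ZMod p) ℂ) :=
    OrderDual.ofDual (MulChar.subgroupOrderIsoSubgroupMulChar (ZMod p) ℂ H) with hX₀
  set X : Finset (MulChar (ZMod p) ℂ) := Finset.univ.filter (· ∈ X₀) with hX
  have hmemX : ∀ χ, χ ∈ X ↔ χ ∈ X₀ := fun χ ↦ by simp [hX]
  have hone : (1 : MulChar (ZMod p) ℂ) ∈ X := (hmemX 1).mpr X₀.one_mem
  have hmul : ∀ χ ∈ X, ∀ ψ ∈ X, χ * ψ ∈ X := fun χ hχ ψ hψ ↦
    (hmemX _).mpr (X₀.mul_mem ((hmemX _).mp hχ) ((hmemX _).mp hψ))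
  have hinv : ∀ χ ∈ X, χ⁻¹ ∈ X := fun χ hχ ↦ (hmemX _).mpr (X₀.inv_mem ((hmemX _).mp hχ))
  have hsep : ∀ m : (ZMod p)ˣ, m ∉ H → ∃ χ ∈ X, χ (m : ZMod p) ≠ 1 := by
    intro m hm
    by_contra hcon
    push Not at hcon
    apply hm
    have h : m ∈ (MulChar.subgroupOrderIsoSubgroupMulChar (ZMod p) ℂ).symm (OrderDual.toDual X₀) :=
      MulChar.mem_subgroupOrderIsoSubgroupMulChar_symm_iff.mpr fun χ hχ ↦ hcon χ ((hmemX χ).mpr hχ)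
    rwa [hX₀, OrderDual.toDual_ofDual, OrderIso.symm_apply_apply] at h
  have hcard : X.card = H.index := by
    have h1 := MulChar.card_subgroupOrderIsoSubgroupMulChar (M := ZMod p) (R := ℂ) (H := H)
    rw [Subgroup.index, ← h1, ← hX₀, Nat.card_eq_fintype_card, ← Fintype.card_subtype]
  -- the inequality at `k := X.card`, in real form
  obtain ⟨hk1, hk2⟩ := moment_ineq_mono (hcard ▸ hn) hineq
  have hsqrt : Real.sqrt p ≤ ((Nat.sqrt p + 1 : ℕ) : ℝ) := by
    have h : (p : ℝ) ≤ ((Nat.sqrt p + 1 : ℕ) : ℝ) ^ 2 := by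
      exact_mod_cast (sq (Nat.sqrt p + 1) ▸ (Nat.lt_succ_sqrt p).le)
    calc Real.sqrt p ≤ Real.sqrt (((Nat.sqrt p + 1 : ℕ) : ℝ) ^ 2) := Real.sqrt_le_sqrt h
      _ = ((Nat.sqrt p + 1 : ℕ) : ℝ) := Real.sqrt_sq (Nat.cast_nonneg _)
  have hineqR : 3 * (((X.card - 1 : ℕ) : ℝ) * (2 + ((X.card - 2 : ℕ) : ℝ) * Real.sqrt p) ^ 2) <
      ((p : ℝ) - 1 - X.card) ^ 2 := by
    have hcast : ((p - 1 - X.card : ℕ) : ℝ) = (p : ℝ) - 1 - X.card := by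
      rw [Nat.sub_sub, Nat.cast_sub (by omega)]; push_cast; ring
    have h2R : (3 : ℝ) * ((X.card - 1 : ℕ) : ℝ) * (2 + ((X.card - 2 : ℕ) : ℝ) * ((Nat.sqrt p + 1 : ℕ) : ℝ)) ^ 2 <
        ((p : ℝ) - 1 - X.card) ^ 2 := by
      rw [← hcast]; exact_mod_cast hk2
    have hle : (2 + ((X.card - 2 : ℕ) : ℝ) * Real.sqrt p) ^ 2 ≤ (2 + ((X.card - 2 : ℕ) : ℝ) * ((Nat.sqrt p + 1 : ℕ) : ℝ)) ^ 2 := by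
      apply pow_le_pow_left₀ (by positivity)
      have := mul_le_mul_of_nonneg_left hsqrt (Nat.cast_nonneg (α := ℝ) (X.card - 2))
      linarith
    nlinarith [Nat.cast_nonneg (α := ℝ) (X.card - 1)]
  refine cuspSpanEvenAtTwo_of_oneStep hp2 fun a x ↦ ?_
  exact CharacterSums.exists_good_pivot X H hone hmul hinv hsep (by omega) hineqR a x

/-- **Per-level certificate (second moment; all hypotheses decidable).** `4^m = 1`, `4^{m/q} ≠ 1` (`q ∈ m.primeFactors`), `m` odd or
`4^{m/2} ≠ −1`, `p − 1 ≤ n·2m`, `n + 1 ≤ p` and the second-moment inequality ⟹ `CuspSpanEvenAtTwo p`. [cite: Pollack2003, Conj. 6.3] -/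
theorem cuspSpanEvenAtTwo_of_check_moment (p m n : ℕ) [Fact p.Prime] (hp2 : p ≠ 2) (hmpos : 0 < m) (hpow : (4 : ZMod p) ^ m = 1)
    (hd : ∀ q ∈ m.primeFactors, (4 : ZMod p) ^ (m / q) ≠ 1) (hneg : m % 2 = 1 ∨ (4 : ZMod p) ^ (m / 2) ≠ -1)
    (hn : p - 1 ≤ n * (2 * m)) (hnp : n + 1 ≤ p)
    (hineq : 3 * (n - 1) * (2 + (n - 2) * (Nat.sqrt p + 1)) ^ 2 < (p - 1 - n) ^ 2) :
    CuspSpanEvenAtTwo p := by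
  have h := (index_closure_mul_two_mul_le hp2 (orderOf_four_eq_of_check hmpos hpow hd) hneg).trans hn
  exact cuspSpanEvenAtTwo_of_index_le_moment hp2 (Nat.le_of_mul_le_mul_right h (by omega)) ⟨hnp, hineq⟩

/-- **Per-level certificate, weak form** (no sign datum; `p − 1 ≤ n·m`). [cite: Pollack2003, Conj. 6.3] -/
theorem cuspSpanEvenAtTwo_of_check_moment' (p m n : ℕ) [Fact p.Prime] (hp2 : p ≠ 2) (hmpos : 0 < m) (hpow : (4 : ZMod p) ^ m = 1)
    (hd : ∀ q ∈ m.primeFactors, (4 : ZMod p) ^ (m / q) ≠ 1) (hn : p - 1 ≤ n * m) (hnp : n + 1 ≤ p)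
    (hineq : 3 * (n - 1) * (2 + (n - 2) * (Nat.sqrt p + 1)) ^ 2 < (p - 1 - n) ^ 2) :
    CuspSpanEvenAtTwo p := by
  have h := (index_closure_mul_le hp2 (orderOf_four_eq_of_check hmpos hpow hd)).trans hn
  exact cuspSpanEvenAtTwo_of_index_le_moment hp2 (Nat.le_of_mul_le_mul_right h hmpos) ⟨hnp, hineq⟩

end Main

/-! ## Instances: the six primes `≤ 3000` missed by the all-pairs theorem -/

section Instances

/-- `CuspSpanEvenAtTwo 631`: `orderOf 4 = 45`, `−1 ∉ ⟨4⟩`, index `7` — NOT covered by the all-pairs inequality, covered by the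
second-moment one. [cite: Pollack2003, Conj. 6.3] -/
theorem cuspSpanEvenAtTwo_moment_631 : CuspSpanEvenAtTwo 631 := by
  have h1 : (4 : ZMod 631) ^ 45 = 1 := by decide +kernel
  have h2 : ∀ q ∈ Nat.primeFactors 45, (4 : ZMod 631) ^ (45 / q) ≠ 1 := by decide +kernel
  haveI : Fact (Nat.Prime 631) := ⟨by norm_num⟩
  exact cuspSpanEvenAtTwo_of_check_moment 631 45 7 (by norm_num) (by norm_num) h1 h2 (Or.inl (by norm_num))
    (by norm_num) (by norm_num) (by norm_num)

/-- `CuspSpanEvenAtTwo 881`: `orderOf 4 = 55`, `−1 ∉ ⟨4⟩`, index `8` — NOT covered by the all-pairs inequality, covered by the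
second-moment one. [cite: Pollack2003, Conj. 6.3] -/
theorem cuspSpanEvenAtTwo_moment_881 : CuspSpanEvenAtTwo 881 := by
  have h1 : (4 : ZMod 881) ^ 55 = 1 := by decide +kernel
  have h2 : ∀ q ∈ Nat.primeFactors 55, (4 : ZMod 881) ^ (55 / q) ≠ 1 := by decide +kernel
  haveI : Fact (Nat.Prime 881) := ⟨by norm_num⟩
  exact cuspSpanEvenAtTwo_of_check_moment 881 55 8 (by norm_num) (by norm_num) h1 h2 (Or.inl (by norm_num))
    (by norm_num) (by norm_num) (by norm_num)

/-- `CuspSpanEvenAtTwo 1201`: `orderOf 4 = 150`, index `8` — NOT covered by the all-pairs inequality, covered by the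
second-moment one. [cite: Pollack2003, Conj. 6.3] -/
theorem cuspSpanEvenAtTwo_moment_1201 : CuspSpanEvenAtTwo 1201 := by
  have h1 : (4 : ZMod 1201) ^ 150 = 1 := by decide +kernel
  have h2 : ∀ q ∈ Nat.primeFactors 150, (4 : ZMod 1201) ^ (150 / q) ≠ 1 := by decide +kernel
  haveI : Fact (Nat.Prime 1201) := ⟨by norm_num⟩
  exact cuspSpanEvenAtTwo_of_check_moment' 1201 150 8 (by norm_num) (by norm_num) h1 h2 (by norm_num) (by norm_num)
    (by norm_num)

/-- `CuspSpanEvenAtTwo 1553`: `orderOf 4 = 97`, `−1 ∉ ⟨4⟩`, index `8` — NOT covered by the all-pairs inequality, covered by the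
second-moment one. [cite: Pollack2003, Conj. 6.3] -/
theorem cuspSpanEvenAtTwo_moment_1553 : CuspSpanEvenAtTwo 1553 := by
  have h1 : (4 : ZMod 1553) ^ 97 = 1 := by decide +kernel
  have h2 : ∀ q ∈ Nat.primeFactors 97, (4 : ZMod 1553) ^ (97 / q) ≠ 1 := by decide +kernel
  haveI : Fact (Nat.Prime 1553) := ⟨by norm_num⟩
  exact cuspSpanEvenAtTwo_of_check_moment 1553 97 8 (by norm_num) (by norm_num) h1 h2 (Or.inl (by norm_num))
    (by norm_num) (by norm_num) (by norm_num)

/-- `CuspSpanEvenAtTwo 1601`: `orderOf 4 = 200`, index `8` — NOT covered by the all-pairs inequality, covered by the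
second-moment one. [cite: Pollack2003, Conj. 6.3] -/
theorem cuspSpanEvenAtTwo_moment_1601 : CuspSpanEvenAtTwo 1601 := by
  have h1 : (4 : ZMod 1601) ^ 200 = 1 := by decide +kernel
  have h2 : ∀ q ∈ Nat.primeFactors 200, (4 : ZMod 1601) ^ (200 / q) ≠ 1 := by decide +kernel
  haveI : Fact (Nat.Prime 1601) := ⟨by norm_num⟩
  exact cuspSpanEvenAtTwo_of_check_moment' 1601 200 8 (by norm_num) (by norm_num) h1 h2 (by norm_num) (by norm_num)
    (by norm_num)

/-- `CuspSpanEvenAtTwo 2381`: `orderOf 4 = 238`, index `10` — NOT covered by the all-pairs inequality, covered by the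
second-moment one. [cite: Pollack2003, Conj. 6.3] -/
theorem cuspSpanEvenAtTwo_moment_2381 : CuspSpanEvenAtTwo 2381 := by
  have h1 : (4 : ZMod 2381) ^ 238 = 1 := by decide +kernel
  have h2 : ∀ q ∈ Nat.primeFactors 238, (4 : ZMod 2381) ^ (238 / q) ≠ 1 := by decide +kernel
  haveI : Fact (Nat.Prime 2381) := ⟨by norm_num⟩
  exact cuspSpanEvenAtTwo_of_check_moment' 2381 238 10 (by norm_num) (by norm_num) h1 h2 (by norm_num) (by norm_num)
    (by norm_num)

end Instances

end Summit.BirchSwinnertonDyer.BirchSwinnertonDyer.Theorems.SignedMuAtTwo
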